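import Mathlib.LinearAlgebra.Dual.Lemmas
import Literature.AlgebraicGeometry.Motives.HodgeTensorDualOpposedProofs
import Literature.AlgebraicGeometry.Motives.HodgeTensorDualProofs
import Literature.AlgebraicGeometry.Motives.MixedHodgeStructure
import Literature.AlgebraicGeometry.Motives.MixedHodgeStructureTateTwist
import HarnessLib

/-!
# The dual of a mixed Hodge structure

Cattani–El Zein–Griffiths–Lê, *Hodge Theory*, §3.2.2.7: "In particular, the dual `H^*` of a mixed
Hodge structure `H` is an MHS" — with the filtrations of Deligne, *Théorie de Hodge II*, 1.1.6–1.1.7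
on the dual of a filtered space: `F^p(V^∨) = (F^{1-p} V)^⊥` (decreasing) and, for the increasing
weight filtration (`W_r = F^{-r}`), `W_r(V^∨) = (W_{-r-1} V)^⊥`; so `Gr^W_r(V^∨) = (Gr^W_{-r} V)^∨` is
pure of weight `r`.

The proof is lattice duality: for `V` finite-dimensional the annihilator `U ↦ U^⊥` is an
order-reversing bijection between the subspaces of `V_ℂ` and of `V_ℂ^∨ ≅ ℂ ⊗ V^∨` (the comparison
`dualBaseChange V` of `HodgeTensor.lean` is bijective, `HodgeTensorDualOpposedProofs.lean`) exchanging
`⊓` and `⊔` and commuting with complex conjugation; it carries the two lattice identities expressing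
`Gr^W_{-r} V = F^{1-p} Gr ⊕ conj F^{1-q} Gr` (`(1-p) + (1-q) = -r + 1`, i.e. `p + q = r + 1`) to the two
identities expressing `Gr^W_r(V^∨) = F^p Gr ⊕ conj F^q Gr` — the roles of the two identities are
swapped, and the modular law `(F ⊔ W') ⊓ W = (F ⊓ W) ⊔ W'` (`W' ≤ W`) absorbs the reversal.

## Main results (all proved; no named facts)

* `baseChange_dualAnnihilator` — `(U^⊥)_ℂ = (U_ℂ)^⊥` for a `ℚ`-subspace `U ⊆ V` (under `dualBaseChange`).
* `complexConj_comap_dualAnnihilator` — `conj (U^⊥) = (conj U)^⊥`.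
* `MixedHodgeStructure.dual H : MixedHodgeStructure (Module.Dual ℚ V)` — **the dual MHS**;
  `dual_W`, `dual_F`.
* `dualBaseChange_dualMap_baseChange` (naturality of `dualBaseChange`) and `Hom.transpose` — the
  transpose `f^∨ : H₂^∨ → H₁^∨` of a morphism of MHS is a morphism of MHS.
* `dualAnnihilator_trivialWeightFiltration` and `HodgeStructure.toMixedHodgeStructure_dual` — for a pure `H`, the MHS of the tree's pure dual
  `HodgeStructure.dual H` is the dual MHS of `H`.

## References

* [CattaniElZeinGriffithsLe2014] E. Cattani et al. (eds.), *Hodge Theory* (2014), §3.2.2.7 (p. 163).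
* [DeligneHodgeII1971] P. Deligne, *Théorie de Hodge II*, 1.1.6–1.1.7, Thm. 2.3.5.
-/

noncomputable section

open scoped TensorProduct

namespace Literature.AlgebraicGeometry.Motives

namespace MixedHodgeStructure

universe u v

variable {V : Type u} [AddCommGroup V] [Module ℚ V]
variable {V' : Type v} [AddCommGroup V'] [Module ℚ V']

open Module
open HodgeStructure (conj complexConj dualBaseChange dualBaseChange_tmul_tmul dualBaseChange_conj
  dualBaseChange_bijective dualBaseChange_injective ker_dualBaseChange mem_complexConj conj_conj)

/-! ### Annihilators, base change and conjugation -/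

/-- `dim_ℂ U_ℂ = dim_ℚ U`. [folklore] -/
private theorem finrank_baseChange_submodule (U : Submodule ℚ V) :
    finrank ℂ (U.baseChange ℂ) = finrank ℚ U := by
  rw [show U.baseChange ℂ = LinearMap.range (U.subtype.baseChange ℂ) from rfl,
    LinearMap.finrank_range_of_inj (baseChange_injective U.injective_subtype), Module.finrank_baseChange]

/-- `comap` along a surjective linear map preserves binary suprema. [folklore] -/
private theorem comap_sup_of_surjective' {M N : Type*} [AddCommGroup M] [Module ℂ M] [AddCommGroup N]
    [Module ℂ N] {f : M →ₗ[ℂ] N} (hf : Function.Surjective f) (X Y : Submodule ℂ N) :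
    (X ⊔ Y).comap f = X.comap f ⊔ Y.comap f := by
  refine le_antisymm ?_ (sup_le (Submodule.comap_mono le_sup_left) (Submodule.comap_mono le_sup_right))
  intro m hm
  obtain ⟨x, hx, y, hy, hxy⟩ := Submodule.mem_sup.1 hm
  obtain ⟨mx, rfl⟩ := hf x
  have hy' : m - mx ∈ Y.comap f := by
    rw [Submodule.mem_comap, map_sub, ← hxy, add_sub_cancel_left]
    exact hy
  rw [← add_sub_cancel mx m]
  exact Submodule.add_mem_sup hx hy'

/-- **Base change of annihilators: `(U^⊥)_ℂ = (U_ℂ)^⊥`** for a `ℚ`-subspace `U` of a finite-dimensional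
`V`, the right-hand side pulled back along the comparison `ℂ ⊗ V^∨ ≅ (ℂ ⊗ V)^∨` (`dualBaseChange V`,
bijective). (`≤` is clear; equality by counting dimensions: both are `dim V - dim U`.)
[cite: DeligneHodgeII1971, 1.1.6–1.1.7] -/
theorem baseChange_dualAnnihilator [FiniteDimensional ℚ V] (U : Submodule ℚ V) :
    (U.dualAnnihilator).baseChange ℂ = ((U.baseChange ℂ).dualAnnihilator).comap (dualBaseChange V) := by
  apply Submodule.eq_of_le_of_finrank_eq
  · rw [Submodule.baseChange_eq_span, Submodule.span_le]
    rintro _ ⟨φ, hφ, rfl⟩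
    rw [SetLike.mem_coe, Submodule.mem_comap, Submodule.mem_dualAnnihilator]
    intro x hx
    rw [Submodule.baseChange_eq_span] at hx
    induction hx using Submodule.span_induction with
    | mem y hy =>
      obtain ⟨u, hu, rfl⟩ := hy
      simp only [TensorProduct.mk_apply, SetLike.mem_coe, Submodule.mem_dualAnnihilator] at hφ ⊢
      rw [dualBaseChange_tmul_tmul, hφ u hu, zero_smul, mul_zero]
    | zero => exact map_zero _
    | add y z _ _ hy hz => rw [map_add, hy, hz, add_zero]
    | smul c y _ hy => rw [map_smul, hy, smul_zero]
  · -- both sides have dimension `dim V - dim U`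
    let e : (ℂ ⊗[ℚ] Module.Dual ℚ V) ≃ₗ[ℂ] Module.Dual ℂ (ℂ ⊗[ℚ] V) :=
      LinearEquiv.ofBijective (dualBaseChange V) dualBaseChange_bijective
    have hcomap : ((U.baseChange ℂ).dualAnnihilator).comap (dualBaseChange V) =
        ((U.baseChange ℂ).dualAnnihilator).map (e.symm : _ →ₗ[ℂ] _) := by
      rw [← Submodule.comap_equiv_eq_map_symm]
      rfl
    have h1 := Subspace.finrank_add_finrank_dualAnnihilator_eq U
    have h2 := Subspace.finrank_add_finrank_dualAnnihilator_eq (U.baseChange ℂ)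
    rw [finrank_baseChange_submodule, Module.finrank_baseChange] at h2
    rw [hcomap, LinearEquiv.finrank_map_eq, finrank_baseChange_submodule]
    omega

/-- **Conjugation commutes with annihilators: `conj (U^⊥) = (conj U)^⊥`** (pulled back along
`dualBaseChange`; rational linear forms are real: `dualBaseChange_conj`). [cite: DeligneHodgeII1971, 1.1.7 and 2.1.4] -/
theorem complexConj_comap_dualAnnihilator (U : Submodule ℂ (ℂ ⊗[ℚ] V)) :
    complexConj ((U.dualAnnihilator).comap (dualBaseChange V)) =
      ((complexConj U).dualAnnihilator).comap (dualBaseChange V) := by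
  ext ξ
  simp only [mem_complexConj, Submodule.mem_comap, Submodule.mem_dualAnnihilator]
  constructor
  · intro h y hy
    have := h (conj y) hy
    rwa [dualBaseChange_conj, conj_conj, map_eq_zero] at this
  · intro h x hx
    rw [dualBaseChange_conj, h (conj x) (by simpa using hx), map_zero]

/-! ### The dual mixed Hodge structure -/

section Dual

variable (H : MixedHodgeStructure V)

/-- The weight filtration of the dual: `W_r(V^∨) = (W_{-r-1} V)^⊥` (Deligne's filtration on the dual,
Hodge II 1.1.7, written for the increasing `W`). [cite: DeligneHodgeII1971, 1.1.7] -/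
def dualW (r : ℤ) : Submodule ℚ (Module.Dual ℚ V) :=
  (H.W (-r - 1)).dualAnnihilator

/-- `r ↦ W_r(V^∨)` is increasing. [cite: DeligneHodgeII1971, 1.1.7] -/
theorem monotone_dualW : Monotone H.dualW := fun _ _ h =>
  Submodule.dualAnnihilator_anti (H.monotone_W (by omega))

/-- The Hodge filtration of the dual: `F^p(V^∨) = (F^{1-p} V)^⊥`, pulled back along
`ℂ ⊗ V^∨ → (ℂ ⊗ V)^∨` (as for the tree's pure `HodgeStructure.dualFiltration`). [cite: DeligneHodgeII1971, 1.1.7] -/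
def dualF (p : ℤ) : Submodule ℂ (ℂ ⊗[ℚ] Module.Dual ℚ V) :=
  ((H.F (1 - p)).dualAnnihilator).comap (dualBaseChange V)

/-- The two opposedness identities of `Gr^W_r(V^∨)` follow from those of `Gr^W_{-r} V` by annihilator
duality (`⊓ ↔ ⊔`, order reversed) and the modular law. [cite: DeligneHodgeII1971, 1.1.7 and Thm. 2.3.5] -/
theorem dual_grOpposed [FiniteDimensional ℚ V] (r p q : ℤ) (hpq : p + q = r + 1) :
    ((H.dualF p ⊓ (H.dualW r).baseChange ℂ) ⊔ (H.dualW (r - 1)).baseChange ℂ) ⊓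
        ((complexConj (H.dualF q) ⊓ (H.dualW r).baseChange ℂ) ⊔ (H.dualW (r - 1)).baseChange ℂ) =
        (H.dualW (r - 1)).baseChange ℂ ∧
      (H.dualF p ⊓ (H.dualW r).baseChange ℂ) ⊔ (complexConj (H.dualF q) ⊓ (H.dualW r).baseChange ℂ) ⊔
        (H.dualW (r - 1)).baseChange ℂ = (H.dualW r).baseChange ℂ := by
  obtain ⟨h1, h2⟩ := H.grOpposed (-r) (1 - p) (1 - q) (by omega)
  -- notation: everything is `(·)^⊥` pulled back along the bijection `dualBaseChange V`
  have hsurj : Function.Surjective (dualBaseChange V) := dualBaseChange_bijective.2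
  set A := (H.W (-r - 1)).baseChange ℂ
  set B := (H.W (-r)).baseChange ℂ
  set F' := H.F (1 - p)
  set G' := complexConj (H.F (1 - q))
  have hAB : A ≤ B := Submodule.baseChange_mono ℂ (H.monotone_W (by omega))
  have hWr : (H.dualW r).baseChange ℂ = (A.dualAnnihilator).comap (dualBaseChange V) := by
    rw [dualW, baseChange_dualAnnihilator]
  have hWr1 : (H.dualW (r - 1)).baseChange ℂ = (B.dualAnnihilator).comap (dualBaseChange V) := by
    rw [dualW, baseChange_dualAnnihilator, show -(r - 1) - 1 = -r by ring]
  have hFp : H.dualF p = (F'.dualAnnihilator).comap (dualBaseChange V) := rfl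
  have hFq : complexConj (H.dualF q) = (G'.dualAnnihilator).comap (dualBaseChange V) := by
    rw [dualF, complexConj_comap_dualAnnihilator]
  rw [hWr, hWr1, hFp, hFq]
  simp only [← Submodule.comap_inf, ← comap_sup_of_surjective' hsurj, ← Submodule.dualAnnihilator_sup_eq,
    ← Subspace.dualAnnihilator_inf_eq]
  refine ⟨congrArg _ (Subspace.dualAnnihilator_inj.2 ?_), congrArg _ (Subspace.dualAnnihilator_inj.2 ?_)⟩
  · -- `((F' ⊔ A) ⊓ B) ⊔ ((G' ⊔ A) ⊓ B) = B`: this is `h2` after the modular law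
    have e1 : (F' ⊓ B) ⊔ A = (F' ⊔ A) ⊓ B := by
      rw [sup_comm (F' ⊓ B) A, ← sup_inf_assoc_of_le F' hAB, sup_comm A F']
    have e2 : (G' ⊓ B) ⊔ A = (G' ⊔ A) ⊓ B := by
      rw [sup_comm (G' ⊓ B) A, ← sup_inf_assoc_of_le G' hAB, sup_comm A G']
    rw [← e1, ← e2, sup_sup_sup_comm, sup_idem]
    exact h2
  · -- `(F' ⊔ A) ⊓ (G' ⊔ A) ⊓ B = A`: this is `h1` after the modular law
    have e1 : (F' ⊓ B) ⊔ A = (F' ⊔ A) ⊓ B := by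
      rw [sup_comm (F' ⊓ B) A, ← sup_inf_assoc_of_le F' hAB, sup_comm A F']
    have e2 : (G' ⊓ B) ⊔ A = (G' ⊔ A) ⊓ B := by
      rw [sup_comm (G' ⊓ B) A, ← sup_inf_assoc_of_le G' hAB, sup_comm A G']
    rw [e1, e2, inf_inf_inf_comm, inf_idem] at h1
    exact h1

/-- **The dual mixed Hodge structure `H^∨`** on `V^∨ = Module.Dual ℚ V` (`V` finite-dimensional):
`W_r(V^∨) = (W_{-r-1} V)^⊥`, `F^p(V^∨) = (F^{1-p} V)^⊥`; `Gr^W_r(V^∨) = (Gr^W_{-r} V)^∨` is a Hodge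
structure of weight `r` (Cattani et al., §3.2.2.7: "In particular, the dual `H^*` of a mixed Hodge
structure `H` is an MHS"). [cite: CattaniElZeinGriffithsLe2014, §3.2.2.7] -/
def dual [FiniteDimensional ℚ V] : MixedHodgeStructure (Module.Dual ℚ V) where
  W := H.dualW
  monotone_W := H.monotone_dualW
  exists_W_eq_bot := by
    obtain ⟨k, hk⟩ := H.exists_W_eq_top
    refine ⟨-k - 1, ?_⟩
    rw [dualW, show -(-k - 1) - 1 = k by ring, hk, Submodule.dualAnnihilator_top]
  exists_W_eq_top := by
    obtain ⟨k, hk⟩ := H.exists_W_eq_bot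
    refine ⟨-k - 1, ?_⟩
    rw [dualW, show -(-k - 1) - 1 = k by ring, hk, Submodule.dualAnnihilator_bot]
  F := H.dualF
  antitone_F _ _ h :=
    Submodule.comap_mono (Submodule.dualAnnihilator_anti (H.antitone_F (by omega)))
  exists_F_eq_top := by
    obtain ⟨p, hp⟩ := H.exists_F_eq_bot
    refine ⟨1 - p, ?_⟩
    rw [dualF, show 1 - (1 - p) = p by ring, hp, Submodule.dualAnnihilator_bot, Submodule.comap_top]
  exists_F_eq_bot := by
    obtain ⟨p, hp⟩ := H.exists_F_eq_top
    refine ⟨1 - p, ?_⟩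
    rw [dualF, show 1 - (1 - p) = p by ring, hp, Submodule.dualAnnihilator_top, Submodule.comap_bot]
    exact ker_dualBaseChange
  isCompl_grF r p q hpq := by
    rw [isCompl_grF_iff, inf_pred_eq_of_monotone H.monotone_dualW]
    exact H.dual_grOpposed r p q hpq

/-- The weight filtration of `H^∨`: `W_r(V^∨) = (W_{-r-1} V)^⊥`. [cite: DeligneHodgeII1971, 1.1.7] -/
@[simp]
theorem dual_W [FiniteDimensional ℚ V] (r : ℤ) : H.dual.W r = (H.W (-r - 1)).dualAnnihilator := rfl

/-- The Hodge filtration of `H^∨`: `F^p(V^∨) = (F^{1-p} V)^⊥` (pulled back along `dualBaseChange`).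
[cite: DeligneHodgeII1971, 1.1.7] -/
@[simp]
theorem dual_F [FiniteDimensional ℚ V] (p : ℤ) :
    H.dual.F p = ((H.F (1 - p)).dualAnnihilator).comap (dualBaseChange V) := rfl

/-- The complexified weight filtration of `H^∨` is the annihilator of that of `H`:
`W_r(V^∨)_ℂ = (W_{-r-1,ℂ})^⊥`. [cite: DeligneHodgeII1971, 1.1.7] -/
theorem baseChange_dual_W [FiniteDimensional ℚ V] (r : ℤ) :
    (H.dual.W r).baseChange ℂ = (((H.W (-r - 1)).baseChange ℂ).dualAnnihilator).comap (dualBaseChange V) :=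
  baseChange_dualAnnihilator _

end Dual

/-! ### Transposes of morphisms -/

/-- **Naturality of `dualBaseChange`**: `dBC ((f^∨)_ℂ ξ) = (dBC ξ) ∘ f_ℂ` — the comparison
`ℂ ⊗ V^∨ → (ℂ ⊗ V)^∨` is natural in `V` (transpose commutes with extension of scalars).
[cite: BourbakiAlgebraI1989, Ch. II §5 no. 4] -/
theorem dualBaseChange_dualMap_baseChange (f : V →ₗ[ℚ] V') (ξ : ℂ ⊗[ℚ] Module.Dual ℚ V')
    (x : ℂ ⊗[ℚ] V) :
    dualBaseChange V (f.dualMap.baseChange ℂ ξ) x = dualBaseChange V' ξ (f.baseChange ℂ x) := by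
  induction ξ using TensorProduct.induction_on with
  | zero => simp
  | tmul c φ =>
    induction x using TensorProduct.induction_on with
    | zero => simp
    | tmul d v =>
      rw [LinearMap.baseChange_tmul, LinearMap.baseChange_tmul, dualBaseChange_tmul_tmul,
        dualBaseChange_tmul_tmul, LinearMap.dualMap_apply]
    | add x y hx hy => rw [map_add, map_add, map_add, hx, hy]
  | add ξ η hξ hη => simp only [map_add, LinearMap.add_apply, hξ, hη]

namespace Hom

variable {H₁ : MixedHodgeStructure V} {H₂ : MixedHodgeStructure V'}

/-- **The transpose `f^∨ : H₂^∨ → H₁^∨` of a morphism of MHS is a morphism of MHS** (`φ ↦ φ ∘ f`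
maps `(W_j V')^⊥` into `(W_j V)^⊥` because `f(W_j V) ⊆ W_j V'`, and likewise for `F` after
complexification). [cite: CattaniElZeinGriffithsLe2014, §3.2.2.7] -/
def transpose [FiniteDimensional ℚ V] [FiniteDimensional ℚ V'] (f : MixedHodgeStructure.Hom H₁ H₂) :
    Hom H₂.dual H₁.dual where
  toLinearMap := f.toLinearMap.dualMap
  map_W_le r := by
    rintro _ ⟨φ, hφ, rfl⟩
    have hφ' : φ ∈ (H₂.W (-r - 1)).dualAnnihilator := hφ
    rw [Submodule.mem_dualAnnihilator] at hφ'
    rw [dual_W, Submodule.mem_dualAnnihilator]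
    intro w hw
    rw [LinearMap.dualMap_apply]
    exact hφ' _ (f.map_W_le _ ⟨w, hw, rfl⟩)
  map_F_le p := by
    rintro _ ⟨ξ, hξ, rfl⟩
    have hξ' : ξ ∈ ((H₂.F (1 - p)).dualAnnihilator).comap (dualBaseChange V') := hξ
    rw [Submodule.mem_comap, Submodule.mem_dualAnnihilator] at hξ'
    rw [dual_F, Submodule.mem_comap, Submodule.mem_dualAnnihilator]
    intro x hx
    rw [dualBaseChange_dualMap_baseChange]
    exact hξ' _ (f.map_F_le _ ⟨x, hx, rfl⟩)

/-- The underlying map of `f.transpose` is `f^∨ = LinearMap.dualMap f`. [cite: CattaniElZeinGriffithsLe2014, §3.2.2.7] -/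
@[simp]
theorem transpose_toLinearMap [FiniteDimensional ℚ V] [FiniteDimensional ℚ V']
    (f : MixedHodgeStructure.Hom H₁ H₂) : f.transpose.toLinearMap = f.toLinearMap.dualMap := rfl

/-- `(g ∘ f)^∨ = f^∨ ∘ g^∨`. [cite: CattaniElZeinGriffithsLe2014, §3.2.2.7] -/
theorem transpose_comp {V'' : Type*} [AddCommGroup V''] [Module ℚ V''] {H₃ : MixedHodgeStructure V''}
    [FiniteDimensional ℚ V] [FiniteDimensional ℚ V'] [FiniteDimensional ℚ V'']
    (g : MixedHodgeStructure.Hom H₂ H₃) (f : MixedHodgeStructure.Hom H₁ H₂) :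
    (g.comp f).transpose = f.transpose.comp g.transpose :=
  Hom.ext (LinearMap.dualMap_comp_dualMap _ _).symm

/-- `id^∨ = id`. [cite: CattaniElZeinGriffithsLe2014, §3.2.2.7] -/
theorem transpose_id [FiniteDimensional ℚ V] : (Hom.id H₁).transpose = Hom.id H₁.dual :=
  Hom.ext LinearMap.dualMap_id

end Hom

/-! ### The dual of a pure Hodge structure -/

/-- The weight filtration of the dual of a pure Hodge structure of weight `n` is the trivial one of
weight `-n`: `(W^{triv,n}_{-r-1})^⊥ = W^{triv,-n}_r`. [cite: DeligneHodgeII1971, 1.1.7] -/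
theorem dualAnnihilator_trivialWeightFiltration (n r : ℤ) :
    (HodgeStructure.trivialWeightFiltration V n (-r - 1)).dualAnnihilator =
      HodgeStructure.trivialWeightFiltration (Module.Dual ℚ V) (-n) r := by
  simp only [HodgeStructure.trivialWeightFiltration]
  by_cases h : r < -n
  · rw [if_neg (show ¬(-r - 1 < n) by omega), if_pos h, Submodule.dualAnnihilator_top]
  · rw [if_pos (show -r - 1 < n by omega), if_neg h, Submodule.dualAnnihilator_bot]

/-- **The MHS of the dual Hodge structure is the dual MHS**: for a pure `H` of weight `n` (the tree's
`HodgeStructure.dual H`, weight `-n`, `HodgeTensor.lean`), `H^∨` viewed as an MHS equals the dual of `H`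
viewed as an MHS — same `F^p = (F^{1-p})^⊥`, and `W^{triv,-n} = (W^{triv,n}_{-·-1})^⊥`.
[cite: CattaniElZeinGriffithsLe2014, §3.2.2.7 and Ex. 3.2.23 (1)] -/
theorem _root_.Literature.AlgebraicGeometry.Motives.HodgeStructure.toMixedHodgeStructure_dual
    [HodgeTensorFacts.{u, u}] [FiniteDimensional ℚ V] {n : ℤ} (H : HodgeStructure V n) :
    H.dual.toMixedHodgeStructure = H.toMixedHodgeStructure.dual :=
  ext_of_W_F (funext fun r => by
      rw [HodgeStructure.toMixedHodgeStructure_W, dual_W, HodgeStructure.toMixedHodgeStructure_W,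
        dualAnnihilator_trivialWeightFiltration])
    (funext fun p => by
      rw [HodgeStructure.toMixedHodgeStructure_F, dual_F, HodgeStructure.dual_F,
        HodgeStructure.toMixedHodgeStructure_F]
      rfl)

end MixedHodgeStructure

end Literature.AlgebraicGeometry.Motives

end
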